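import Literature.MathematicalPhysics.QuantumFieldTheory.Balaban1983to89.B9Thm33SourceWitnessZdPerNested

/-!
# `Balaban1983to89.B9Thm33BindersUniformZdPerNested` — [Balaban1985BackgroundPropagators] Thm 3.11 p. 416 ∕ Thm 3.3 (3.42)–(3.47) p. 397–398 for the GENUINE periodic record
# at the nested periodic members of [Balaban1985RegularSpaces]'s class: (§1–§2) the record `opsAllZdPer` and its five junction binders READ THE MEMBER ONLY THROUGH
# `(η, k, Ω, Λs m↾≤m)` and the class through `𝔅 m↾≤m` (congruence in every unread coordinate — the index's junk values `Λs m l`, `l > m`, and the base letters `ops₀` are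
# never read); (§4) hence, AT A FIXED PERIOD `P` and GIVEN THAT `η` IS A FUNCTION OF THE DEPTH `k` ON THE INDEX (print's `η = L⁻ᵏ`), the N05 witness slot's five N06
# binders hold with ONE constant set `aI aT B₀ C_β c_S c_Sβ` for ALL members `j : IdxB8SubDPerκ θ P Mκ Rκ` and all truncations `m ≤ k` — the `∀∃ ⇒ ∃∀` step over members,
# by finiteness of the codes `(k, (Ω_l on the torus)_{l ≤ P})` and `min ∕ max` of the per-member constants of `B9Thm33SourceWitnessZdPerNested`

statement-level skeleton of published theorems with citation tags; proofs where landed; nothing here is a claim about the Yang–Mills mass gap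

`[Balaban1985BackgroundPropagators]` ("B9", CMP **99** (1985) 389–434): Thm 3.11 p. 416, Thm 3.3 p. 399, (3.16) p. 393, (3.21)–(3.25) p. 394, (3.26)–(3.27) p. 395, (3.42) p. 397,
(3.43)–(3.47) p. 398.  `[Balaban1985RegularSpaces]` ("B8", CMP **99**): (1.3)–(1.6) p. 77, p. 77 *«T_η, η = L^{−k}»*, *«Ω_j ⊂ T_η»*, (1.31) p. 82, (1.58)–(1.59) p. 86, Thm 8 + (1.146)
p. 101.

CITATION HEADER (lean-in-tree rule).  Cell `pub-ymgap` (YM Track A), DAG node N06 = [B9], seat `pub-ymgap-dag-n06-b` (g25), the (β′-PERIODIC) road.  WHY: this seat's LOCATED-SELF-9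
(bus 2026-08-28 23:51Z), ref-A g37's WATCH-AI-UNIFORMITY (READ-20) and dag-n05-d g22's head-side ANSWER (00:03Z): the N05 witness slot of record (`…OfBindersLettersPer(Door)`) and
dag-n24-c's K1-face door display N06's binder constants OUTSIDE `∀ a`; `B9Thm33SourceWitnessZdPerNested` (p679502) supplies them PER MEMBER (`∀ a, ∃ …`); n05-d's preferred road
is «(ii)(b) pin `η := L⁻ᵏ` by a director word + (i-lite) junk-congruence + finiteness over `(k, Ω)` at fixed `P`».  THIS FILE IS (i-lite): §1 the periodic letters (`N_𝔤^per`, `R^per`,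
`Q′ᵀ`, `Q*aQ`, `G_𝔤^per`) read the families ∕ classes below the truncation only and `G_𝔤^per` reads the record only through `Δ_a`; §2 hence `Δ_a`, `G_𝔤^per`, `D R^per D*` of the
genuine record and the five binders are the SAME STATEMENT at two members agreeing on `(η, k, Ω, Λs m↾≤m)` with classes agreeing below `m`; §3 print's class reads `Λ l′`,
`l′ ≤ l`; §4 the uniformization under an `η`-law hypothesis `hηk : ∀ j, j.toZdIdx.η = ηfun j.toZdIdx.k` — discharged by print's `η = L⁻ᵏ` once the index is so cut (director's
word; the tree's law №7 `Lᵏη ≤ 1` is a relaxation); without it, the remaining step is the `η`-SCALING of `Δ_a` (every letter homogeneous of degree `−2` in `η`), NOT in this file.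

WHAT IS PROVED (kernel, 0 sorry; theorems only — no `def`, no `instance`, no `notation`).
* §1 `gaugeNullPer_congr`, `rangeSubPer_congr`, `projEPer_congr`, `projRPer_congr`, `QT_congr`, `clsField_congr`, ★ `QQZdP_congr`, ★ `gopZdHPer_congr` (`G_𝔤^per(U₀)` reads the
  record only through `Δ_a(U₀)`: the regime predicate and the inverse are built from `deltaAOf η o U₀` alone).
* §2 ★ `deltaAOf_opsAllZdPer_congr`, ★ `gop_opsAllZdPer_congr`, `DRDs_opsAllZdPer_congr`; ★★ `invAtHIPer_congr`, `globAtIPer_congr`, `holderAtIH2Per_congr`, `srcAtIPer_congr`,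
  `srcHolderAtIH2Per_congr` (↔ at members agreeing on `(η, k, Ω, Λs m↾≤m)`, classes agreeing on `𝔅 m↾≤m`).
* §3 `towerBondsP_congr`.
* §4 `IdxB8SubDPerκ.k_le_period` (`k < Lᵏ ≤ P`), `IdxB8SubDPerκ.Ω_eq_of_code_eq` (same depth + same torus readings for `l ≤ P` ⟹ same `Ω`; beyond the depth both `∅`),
  ★★★★★★ `IdxB8SubDPerκ.binders_uniform_of_eta_law` — `(∀ j, j.η = ηfun j.k) → ∃ aI aT > 0, B₀ > 0, C_β c_S c_Sβ ≥ 0, ∀ j : IdxB8SubDPerκ θ P Mκ Rκ, ∀ m ≤ k,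
  InvAtHIPer … aI ∧ GlobAtIPer … aT B₀ ∧ HolderAtIH2Per … aT C_β β len ∧ SrcAtIPer … aT c_S ∧ SrcHolderAtIH2Per … aT c_Sβ β len` for
  `opsAllZdPer τ θ.L P (fun k l => towerBondsP θ.L j.toZdIdx.Ω (j.toZdIdx.Λs k) l) ops₀ … M j.toZdIdx m` (`2 ≤ D`, `0 ≤ β`, integer lengths) — the head's texts with the constants
  OUTSIDE `∀ a` (`a_S := a_T`; n05-d: consumed at ζ-L ∕ p675424's `hN05` by `obtain` + two glue lines).

HONEST SCOPE.  (i) CONDITIONAL on the `η`-law (a displayed hypothesis, not a named fact): TRUE for print's members (`η = L⁻ᵏ`, p. 77) and dischargeable by an `η`-cut of the index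
(director word à la №220 (A-4)); for the tree's relaxed index (`Lᵏη ≤ 1`) it is FALSE as a universal statement, and the uniformization then needs the `η`-scaling of `Δ_a`.  (ii) The
constants are per PERIOD `P` (and `τ`, `M`, `β`, `len`): volume-uniformity in `P` (print's Thm 3.3 ∕ 3.11 «uniformly in U, Ω_j», the `P_k = N·Lᵏ` ladder of dag-n16) is NOT proved
— the coercivity ∕ random-walk lanes' content.  (iii) Count-neutral; N06 NOT discharged; K1⁹ NOT closed; counts UNMOVED; one finite `𝕋⁴` programme at fixed `ε`, Bałaban as
printed; nothing continuum ∕ ℝ⁴ ∕ OS ∕ mass gap ∕ Clay.  Unit `pub-ymgap-dag-n06-b` (g25), 2026-08-29; NEW file importing this seat's `B9Thm33SourceWitnessZdPerNested`; modifies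
nothing.  Net new unproved facts: 0.
-/

noncomputable section

namespace Literature.MathematicalPhysics.QuantumFieldTheory.Balaban1983to89.B9Thm33BindersUniformZdPerNested

open B7Prop1Explicit B7Prop2Explicit
open B8Ineq132 (covDerivFwd InAk plaqF)
open B8ScaledSupNorm (bondNorm msup Bdd)
open B8Eq138LandauZd (covLap covDivB QT)
open B8LeafModelZd (ZdIdx)
open B9SupplySockB9P3ZdLetters (OpsZd deltaAOf)
open B9SupplySockB9P3ZdGammaInAkDpZd (withDpZd)
open B9Eq316AveragingTransposeZd (Reg17 clsField)
open B9Eq316AveragingTransposeZdPrinted (withQQP QQZdP)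
open B9Eq327GreenZdHermPer (domSubHPer RegularAtHPer InvAtHIPer gopZdHPer withGopZdHPer)
open B9SupplySockB9P3ZdPer (GlobAtIPer)
open B9SupplySockB9P3ZdH2Per (HolderAtIH2Per)
open B9SupplySockB9P3ZdAllLettersZdPer (opsAllZdPer opsLandauPer opsAllZdPer_DRDs deltaAOf_opsAllZdPer_apply)
open B9SupplySockB9P3ZdSrcPer (SrcAtIPer SrcHolderAtIH2Per)
open B9Eq321LandauProjectionZdPer (perSub gaugeNullPer rangeGenPer rangeSubPer projEPer projRPer)
open B8TowerBondsPrinted (towerBondsP)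
open Node00 (Stage3Params IdxB8SubD IdxB8SubDPer IdxB8SubDPerκ)
open T4TermwiseTorus (IsPeriodic tcls)

-- `Site` alone could resolve to the torus sites of `Setup.lean`; re-export the `ℤ^d` sites of `B7Prop1Explicit`.
export B7Prop1Explicit (Site)

variable {d : ℕ} {𝔸 : Type*} [CStarAlgebra 𝔸]

/-! ## §1  The periodic letters read the constraint families and classes BELOW THE TRUNCATION ONLY: congruence in the unread coordinates -/

section Congr

variable {P L m : ℕ} {η : ℝ} {Λ Λ' : ℕ → Set (Site d)} {U₀ : Site d → Fin d → 𝔸ˣ}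

/-- the gauge null space `N_𝔤^per(Q′(U₀))` reads `Λ j` for `j ≤ m` only. [cite: Balaban1985BackgroundPropagators, (3.21) p.394 (bookkeeping)] -/
theorem gaugeNullPer_congr (h : ∀ j, j ≤ m → Λ j = Λ' j) : gaugeNullPer (𝔸 := 𝔸) P L m Λ U₀ = gaugeNullPer P L m Λ' U₀ := by
  ext lam
  simp only [gaugeNullPer, Set.mem_setOf_eq]
  refine and_congr_right fun _ => and_congr_right fun _ => forall_congr' fun j => forall_congr' fun hj => ?_
  rw [h j hj]

/-- … hence so do the range generators, the range, the Landau projection `E^per` and `R^per(U₀)`.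
[cite: Balaban1985BackgroundPropagators, (3.21)–(3.22) p.394 (bookkeeping)] -/
theorem rangeSubPer_congr (h : ∀ j, j ≤ m → Λ j = Λ' j) : rangeSubPer (𝔸 := 𝔸) P L m η Λ U₀ = rangeSubPer P L m η Λ' U₀ := by
  unfold rangeSubPer rangeGenPer
  rw [gaugeNullPer_congr h]

/-- [cite: Balaban1985BackgroundPropagators, (3.22) p.394 (bookkeeping)] -/
theorem projEPer_congr (τ : 𝔸 →ₗ[ℂ] ℂ) (h : ∀ j, j ≤ m → Λ j = Λ' j) : projEPer τ P L m η Λ U₀ = projEPer τ P L m η Λ' U₀ := by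
  unfold projEPer
  rw [rangeSubPer_congr h]

/-- [cite: Balaban1985BackgroundPropagators, (3.22) p.394 (bookkeeping)] -/
theorem projRPer_congr (τ : 𝔸 →ₗ[ℂ] ℂ) (h : ∀ j, j ≤ m → Λ j = Λ' j) : projRPer τ P L m η Λ U₀ = projRPer τ P L m η Λ' U₀ := by
  funext f x
  unfold projRPer
  rw [projEPer_congr τ h]

/-- the multi-level transpose stencil `Q′(U₀)ᵀ` reads `Λ j` for `j ≤ m` only. [cite: Balaban1985BackgroundPropagators, (3.24) p.394 (bookkeeping)] -/
theorem QT_congr (h : ∀ j, j ≤ m → Λ j = Λ' j) (μ : ℕ → Site d → 𝔸) (x : Site d) :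
    QT L m Λ U₀ μ x = QT L m Λ' U₀ μ x := by
  unfold QT
  exact Finset.sum_congr rfl fun j hj => by rw [h j (Nat.lt_succ_iff.1 (Finset.mem_range.1 hj))]

/-- the class field of the averaging letter reads `𝔅 m j` only. [cite: Balaban1985BackgroundPropagators, (3.16) p.393 (bookkeeping)] -/
theorem clsField_congr {𝔅 𝔅' : ℕ → ℕ → Set (Site d × Fin d)} {j : ℕ} (h : 𝔅 m j = 𝔅' m j) (A : Site d → Fin d → 𝔸) :
    clsField L 𝔅 η m j U₀ A = clsField L 𝔅' η m j U₀ A := by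
  funext z κ
  unfold clsField
  rw [h]

variable [FiniteDimensional ℝ 𝔸]

/-- ★ **THE GENUINE AVERAGING LETTER `Q*aQ(U₀)` READS THE MEMBER'S `η`, `Ω` AND THE CLASS `𝔅 m j`, `j ≤ m`, ONLY.**
[cite: Balaban1985BackgroundPropagators, (3.16) p.393, (3.26) p.395 (bookkeeping)] -/
theorem QQZdP_congr (τ : 𝔸 →ₗ[ℂ] ℂ) {𝔅 𝔅' : ℕ → ℕ → Set (Site d × Fin d)} {i i' : ZdIdx d L} (hη : i.η = i'.η) (hΩ : i.Ω = i'.Ω)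
    (h𝔅 : ∀ j, j ≤ m → 𝔅 m j = 𝔅' m j) : QQZdP τ L 𝔅 i m = QQZdP τ L 𝔅' i' m := by
  funext U₀ A y μ
  unfold QQZdP
  rw [hη, hΩ]
  split_ifs with hreg
  · exact Finset.sum_congr rfl fun j hj => by rw [clsField_congr (h𝔅 j (Nat.lt_succ_iff.1 (Finset.mem_range.1 hj))) A]
  · rfl

omit [FiniteDimensional ℝ 𝔸] in
/-- ★ **`G_𝔤^per(U₀)` READS THE RECORD ONLY THROUGH `Δ_a(U₀)`** (the regime predicate and the inverse are built from `deltaAOf η o U₀` alone; the record's own `Gop`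
field is never read). [cite: Balaban1985BackgroundPropagators, (3.27) p.395 (bookkeeping)] -/
theorem gopZdHPer_congr {o o' : OpsZd d 𝔸} (h : deltaAOf η o U₀ = deltaAOf η o' U₀) : gopZdHPer η o P U₀ = gopZdHPer η o' P U₀ := by
  have hreg : RegularAtHPer η o P U₀ ↔ RegularAtHPer η o' P U₀ := by
    simp only [RegularAtHPer, h]
  funext J
  by_cases hr : RegularAtHPer η o P U₀
  · have hr' : RegularAtHPer η o' P U₀ := hreg.1 hr
    rw [B9Eq327GreenZdHermPer.gopZdHPer_of_regularAtHPer η o P U₀ hr, B9Eq327GreenZdHermPer.gopZdHPer_of_regularAtHPer η o' P U₀ hr']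
    set e := B9Eq327GreenZdHermPer.deltaAEquivHPer η o P U₀ hr with he
    set e' := B9Eq327GreenZdHermPer.deltaAEquivHPer η o' P U₀ hr' with he'
    set x := e.symm (B9Eq327GreenZdHermPer.restrictLinHPer P J) with hx
    set x' := e'.symm (B9Eq327GreenZdHermPer.restrictLinHPer P J) with hx'
    suffices hxx : x = x' by rw [hxx]
    apply e.injective
    apply Subtype.ext
    have h1 : e x = B9Eq327GreenZdHermPer.restrictLinHPer P J := by rw [hx, LinearEquiv.apply_symm_apply]
    have h2 : e' x' = B9Eq327GreenZdHermPer.restrictLinHPer P J := by rw [hx', LinearEquiv.apply_symm_apply]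
    rw [h1, ← h2, B9Eq327GreenZdHermPer.deltaAEquivHPer_coe, B9Eq327GreenZdHermPer.deltaAEquivHPer_coe, h]
  · have hr' : ¬ RegularAtHPer η o' P U₀ := fun h' => hr (hreg.2 h')
    rw [B9Eq327GreenZdHermPer.gopZdHPer_of_not_regularAtHPer η o P U₀ hr, B9Eq327GreenZdHermPer.gopZdHPer_of_not_regularAtHPer η o' P U₀ hr']

end Congr

/-! ## §2  The genuine periodic record and its five binders read the member only through `(η, k, Ω, Λs m↾≤m)` and the class through `𝔅 m↾≤m` -/

section Record

variable [FiniteDimensional ℝ 𝔸] (τ : 𝔸 →ₗ[ℂ] ℂ) (P : ℕ) {L : ℕ} (ops₀ : ℝ → ZdIdx d L → ℕ → OpsZd d 𝔸) (M : ℝ)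
  {i i' : ZdIdx d L} {m : ℕ} {𝔅 𝔅' : ℕ → ℕ → Set (Site d × Fin d)}

/-- ★ **`Δ_a(U₀)` OF THE GENUINE RECORD READS `(η, Ω, Λs m↾≤m, 𝔅 m↾≤m)` ONLY** (any outer `η₀` in the `D*D` letter): two members agreeing there have the same four-letter
operator (the record's own `ops₀` letters are all overwritten; the base `Gop` field is never read). [cite: Balaban1985BackgroundPropagators, (3.26) p.395 (bookkeeping)] -/
theorem deltaAOf_opsAllZdPer_congr (hη : i.η = i'.η) (hΩ : i.Ω = i'.Ω) (hΛ : ∀ l, l ≤ m → i.Λs m l = i'.Λs m l)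
    (h𝔅 : ∀ l, l ≤ m → 𝔅 m l = 𝔅' m l) (η₀ : ℝ) (U₀ : Site d → Fin d → 𝔸ˣ) :
    deltaAOf η₀ (opsAllZdPer τ L P 𝔅 ops₀ M i m) U₀ = deltaAOf η₀ (opsAllZdPer τ L P 𝔅' ops₀ M i' m) U₀ := by
  funext A x μ
  have hDp : (opsAllZdPer τ L P 𝔅 ops₀ M i m).Dp = B9Eq369CurvSmallZd.DpZd i.η := rfl
  have hDp' : (opsAllZdPer τ L P 𝔅' ops₀ M i' m).Dp = B9Eq369CurvSmallZd.DpZd i'.η := rfl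
  have hQQ : (opsAllZdPer τ L P 𝔅 ops₀ M i m).QQ = QQZdP τ L 𝔅 i m := rfl
  have hQQ' : (opsAllZdPer τ L P 𝔅' ops₀ M i' m).QQ = QQZdP τ L 𝔅' i' m := rfl
  simp only [deltaAOf]
  rw [hDp, hDp', hQQ, hQQ', opsAllZdPer_DRDs, opsAllZdPer_DRDs, hη, projRPer_congr τ hΛ, QQZdP_congr τ hη hΩ h𝔅]

/-- ★ **`G_𝔤^per(U₀)` OF THE GENUINE RECORD READS `(η, Ω, Λs m↾≤m, 𝔅 m↾≤m)` ONLY.** [cite: Balaban1985BackgroundPropagators, (3.27) p.395 (bookkeeping)] -/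
theorem gop_opsAllZdPer_congr (hη : i.η = i'.η) (hΩ : i.Ω = i'.Ω) (hΛ : ∀ l, l ≤ m → i.Λs m l = i'.Λs m l)
    (h𝔅 : ∀ l, l ≤ m → 𝔅 m l = 𝔅' m l) (U₀ : Site d → Fin d → 𝔸ˣ) :
    (opsAllZdPer τ L P 𝔅 ops₀ M i m).Gop U₀ = (opsAllZdPer τ L P 𝔅' ops₀ M i' m).Gop U₀ := by
  have h1 : (opsAllZdPer τ L P 𝔅 ops₀ M i m).Gop U₀ = gopZdHPer i.η (opsLandauPer τ P (withDpZd (withQQP τ L 𝔅 ops₀)) M i m) P U₀ := rfl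
  have h2 : (opsAllZdPer τ L P 𝔅' ops₀ M i' m).Gop U₀ = gopZdHPer i'.η (opsLandauPer τ P (withDpZd (withQQP τ L 𝔅' ops₀)) M i' m) P U₀ := rfl
  have h3 : ∀ (η₀ : ℝ) (j : ZdIdx d L) (𝔅₀ : ℕ → ℕ → Set (Site d × Fin d)),
      deltaAOf η₀ (opsLandauPer τ P (withDpZd (withQQP τ L 𝔅₀ ops₀)) M j m) U₀ = deltaAOf η₀ (opsAllZdPer τ L P 𝔅₀ ops₀ M j m) U₀ := fun _ _ _ => rfl
  rw [h1, h2, hη]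
  refine gopZdHPer_congr ?_
  rw [h3, h3]
  exact deltaAOf_opsAllZdPer_congr τ P ops₀ M hη hΩ hΛ h𝔅 i'.η U₀

/-- ★ **`D R^per D*` OF THE GENUINE RECORD READS `(η, Λs m↾≤m)` ONLY.** [cite: Balaban1985BackgroundPropagators, (3.26) p.395, (3.22) p.394 (bookkeeping)] -/
theorem DRDs_opsAllZdPer_congr (hη : i.η = i'.η) (hΛ : ∀ l, l ≤ m → i.Λs m l = i'.Λs m l) (U₀ : Site d → Fin d → 𝔸ˣ) :
    (opsAllZdPer τ L P 𝔅 ops₀ M i m).DRDs U₀ = (opsAllZdPer τ L P 𝔅' ops₀ M i' m).DRDs U₀ := by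
  funext A x μ
  rw [opsAllZdPer_DRDs, opsAllZdPer_DRDs, hη, projRPer_congr τ hΛ]

variable {P}

/-- ★★ **`InvAtHIPer` AT TWO MEMBERS AGREEING ON `(η, Ω, Λs m↾≤m)` WITH CLASSES AGREEING ON `𝔅 m↾≤m` IS THE SAME STATEMENT.**
[cite: Balaban1985BackgroundPropagators, (3.27) p.395; Balaban1985RegularSpaces, (1.58) p.86 (bookkeeping)] -/
theorem invAtHIPer_congr (hη : i.η = i'.η) (hΩ : i.Ω = i'.Ω) (hΛ : ∀ l, l ≤ m → i.Λs m l = i'.Λs m l)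
    (h𝔅 : ∀ l, l ≤ m → 𝔅 m l = 𝔅' m l) {aI : ℝ} :
    InvAtHIPer P L (opsAllZdPer τ L P 𝔅 ops₀) aI M i m ↔ InvAtHIPer P L (opsAllZdPer τ L P 𝔅' ops₀) aI M i' m := by
  have hΔ : ∀ U₀, deltaAOf i'.η (opsAllZdPer τ L P 𝔅 ops₀ M i m) U₀ = deltaAOf i'.η (opsAllZdPer τ L P 𝔅' ops₀ M i' m) U₀ :=
    fun U₀ => deltaAOf_opsAllZdPer_congr τ P ops₀ M hη hΩ hΛ h𝔅 i'.η U₀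
  have hG : ∀ U₀, (opsAllZdPer τ L P 𝔅 ops₀ M i m).Gop U₀ = (opsAllZdPer τ L P 𝔅' ops₀ M i' m).Gop U₀ :=
    fun U₀ => gop_opsAllZdPer_congr τ P ops₀ M hη hΩ hΛ h𝔅 U₀
  unfold InvAtHIPer
  rw [hη, hΩ]
  simp only [hΔ, hG]

/-- ★★ the same for `GlobAtIPer`. [cite: Balaban1985BackgroundPropagators, (3.47) p.398 (bookkeeping)] -/
theorem globAtIPer_congr (hη : i.η = i'.η) (hΩ : i.Ω = i'.Ω) (hΛ : ∀ l, l ≤ m → i.Λs m l = i'.Λs m l)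
    (h𝔅 : ∀ l, l ≤ m → 𝔅 m l = 𝔅' m l) {aT B₀ : ℝ} :
    GlobAtIPer P L (opsAllZdPer τ L P 𝔅 ops₀) aT B₀ M i m ↔ GlobAtIPer P L (opsAllZdPer τ L P 𝔅' ops₀) aT B₀ M i' m := by
  have hG : ∀ U₀, (opsAllZdPer τ L P 𝔅 ops₀ M i m).Gop U₀ = (opsAllZdPer τ L P 𝔅' ops₀ M i' m).Gop U₀ :=
    fun U₀ => gop_opsAllZdPer_congr τ P ops₀ M hη hΩ hΛ h𝔅 U₀
  unfold GlobAtIPer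
  rw [hη, hΩ]
  simp only [hG]

/-- ★★ the same for `HolderAtIH2Per`. [cite: Balaban1985BackgroundPropagators, (3.45) p.398 (bookkeeping)] -/
theorem holderAtIH2Per_congr (hη : i.η = i'.η) (hΩ : i.Ω = i'.Ω) (hΛ : ∀ l, l ≤ m → i.Λs m l = i'.Λs m l)
    (h𝔅 : ∀ l, l ≤ m → 𝔅 m l = 𝔅' m l) {aT Cβ β : ℝ} {len : Site d → ℝ} :
    HolderAtIH2Per P L (opsAllZdPer τ L P 𝔅 ops₀) aT Cβ β len M i m ↔ HolderAtIH2Per P L (opsAllZdPer τ L P 𝔅' ops₀) aT Cβ β len M i' m := by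
  have hG : ∀ U₀, (opsAllZdPer τ L P 𝔅 ops₀ M i m).Gop U₀ = (opsAllZdPer τ L P 𝔅' ops₀ M i' m).Gop U₀ :=
    fun U₀ => gop_opsAllZdPer_congr τ P ops₀ M hη hΩ hΛ h𝔅 U₀
  unfold HolderAtIH2Per
  rw [hη, hΩ]
  simp only [hG]

/-- ★★ the same for `SrcAtIPer` (also reads `k` and `Q′(U₀)ᵀ` over `Λs m`). [cite: Balaban1985BackgroundPropagators, (3.42) p.397; Balaban1985RegularSpaces, (1.146) p.101 (bookkeeping)] -/
theorem srcAtIPer_congr (hη : i.η = i'.η) (hk : i.k = i'.k) (hΩ : i.Ω = i'.Ω) (hΛ : ∀ l, l ≤ m → i.Λs m l = i'.Λs m l)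
    (h𝔅 : ∀ l, l ≤ m → 𝔅 m l = 𝔅' m l) {aS cS : ℝ} :
    SrcAtIPer P L (opsAllZdPer τ L P 𝔅 ops₀) aS cS M i m ↔ SrcAtIPer P L (opsAllZdPer τ L P 𝔅' ops₀) aS cS M i' m := by
  have hG : ∀ U₀, (opsAllZdPer τ L P 𝔅 ops₀ M i m).Gop U₀ = (opsAllZdPer τ L P 𝔅' ops₀ M i' m).Gop U₀ :=
    fun U₀ => gop_opsAllZdPer_congr τ P ops₀ M hη hΩ hΛ h𝔅 U₀
  have hD : ∀ U₀, (opsAllZdPer τ L P 𝔅 ops₀ M i m).DRDs U₀ = (opsAllZdPer τ L P 𝔅' ops₀ M i' m).DRDs U₀ :=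
    fun U₀ => DRDs_opsAllZdPer_congr τ P ops₀ M hη hΛ U₀
  have hQT : ∀ U₀ : Site d → Fin d → 𝔸ˣ, QT L m (i.Λs m) U₀ = QT L m (i'.Λs m) U₀ := fun U₀ => by
    funext μ x; exact QT_congr hΛ μ x
  unfold SrcAtIPer
  rw [hη, hΩ, hk]
  simp only [hG, hD, hQT]

/-- ★★ the same for `SrcHolderAtIH2Per`. [cite: Balaban1985BackgroundPropagators, (3.43) p.398; Balaban1985RegularSpaces, (1.146) p.101 (bookkeeping)] -/
theorem srcHolderAtIH2Per_congr (hη : i.η = i'.η) (hk : i.k = i'.k) (hΩ : i.Ω = i'.Ω) (hΛ : ∀ l, l ≤ m → i.Λs m l = i'.Λs m l)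
    (h𝔅 : ∀ l, l ≤ m → 𝔅 m l = 𝔅' m l) {aS cSβ β : ℝ} {len : Site d → ℝ} :
    SrcHolderAtIH2Per P L (opsAllZdPer τ L P 𝔅 ops₀) aS cSβ β len M i m ↔
      SrcHolderAtIH2Per P L (opsAllZdPer τ L P 𝔅' ops₀) aS cSβ β len M i' m := by
  have hG : ∀ U₀, (opsAllZdPer τ L P 𝔅 ops₀ M i m).Gop U₀ = (opsAllZdPer τ L P 𝔅' ops₀ M i' m).Gop U₀ :=
    fun U₀ => gop_opsAllZdPer_congr τ P ops₀ M hη hΩ hΛ h𝔅 U₀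
  have hD : ∀ U₀, (opsAllZdPer τ L P 𝔅 ops₀ M i m).DRDs U₀ = (opsAllZdPer τ L P 𝔅' ops₀ M i' m).DRDs U₀ :=
    fun U₀ => DRDs_opsAllZdPer_congr τ P ops₀ M hη hΛ U₀
  have hQT : ∀ U₀ : Site d → Fin d → 𝔸ˣ, QT L m (i.Λs m) U₀ = QT L m (i'.Λs m) U₀ := fun U₀ => by
    funext μ x; exact QT_congr hΛ μ x
  unfold SrcHolderAtIH2Per
  rw [hη, hΩ, hk]
  simp only [hG, hD, hQT]

end Record

/-! ## §3  Print's class of a Λ-tower reads `Λ l′`, `l′ ≤ l`, only -/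

section Tower

/-- `towerBondsP L Ω Λ l` reads `Λ l` and `Λ (l − 1)` only. [cite: Balaban1985RegularSpaces, (1.31) p.82 (bookkeeping)] -/
theorem towerBondsP_congr {L : ℕ} {Ω Λ Λ' : ℕ → Set (Site d)} {l : ℕ} (h : ∀ l', l' ≤ l → Λ l' = Λ' l') :
    towerBondsP L Ω Λ l = towerBondsP L Ω Λ' l := by
  ext c
  rw [B8TowerBondsPrinted.mem_towerBondsP_iff, B8TowerBondsPrinted.mem_towerBondsP_iff, h l le_rfl]
  have h1 : ∀ j', l = j' + 1 → Λ j' = Λ' j' := fun j' hj => h j' (by omega)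
  refine or_congr Iff.rfl (and_congr Iff.rfl (or_congr ?_ ?_))
  · exact exists_congr fun j' => and_congr_right fun hj => by rw [h1 j' hj]
  · exact exists_congr fun j' => and_congr_right fun hj => by rw [h1 j' hj]

end Tower

/-! ## §4  UNIFORM CONSTANTS OVER ALL MEMBERS OF THE N05 HEAD's INDEX AT A FIXED PERIOD, given that `η` is a function of the depth `k` -/

section Uniform

variable {θ : Stage3Params} [FiniteDimensional ℝ θ.𝔸] (τ : θ.𝔸 →ₗ[ℂ] ℂ) (hτp : ∀ x : θ.𝔸, x ≠ 0 → 0 < (τ (star x * x)).re)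
  (hτt : ∀ x y : θ.𝔸, τ (x * y) = τ (y * x)) (hτs : ∀ x : θ.𝔸, τ (star x) = starRingEnd ℂ (τ x)) {P Mκ Rκ : ℕ} [NeZero P]

omit [FiniteDimensional ℝ θ.𝔸] [NeZero P] in
/-- the depth of a periodic member is at most the period: `k < Lᵏ ≤ P`. [cite: Balaban1985RegularSpaces, p.77 («Ω_j ⊂ T_η», `Lᵏ ∣ P`; bookkeeping)] -/
theorem IdxB8SubDPerκ.k_le_period (j : IdxB8SubDPerκ θ P Mκ Rκ) : j.toZdIdx.k ≤ P := by
  have h1 : θ.L ^ j.toZdIdx.k ≤ P := Nat.le_of_dvd j.toPer.pos j.toPer.dvd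
  have h2 : j.toZdIdx.k < θ.L ^ j.toZdIdx.k := Nat.lt_pow_self (by have := θ.two_le_L; omega)
  omega

omit [FiniteDimensional ℝ θ.𝔸] [NeZero P] in
/-- two periodic members with the same depth and the same torus readings of `Ω_l`, `l ≤ P`, have the same `Ω` (pull back along `tcls`; beyond the depth both are `∅`).
[cite: Balaban1985RegularSpaces, (1.3) p.77, p.77 («Ω_j ⊂ T_η»; bookkeeping)] -/
theorem IdxB8SubDPerκ.Ω_eq_of_code_eq (j j' : IdxB8SubDPerκ θ P Mκ Rκ) (hk : j.toZdIdx.k = j'.toZdIdx.k)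
    (hT : ∀ l, l ≤ P → j.toPer.ΩTorus l = j'.toPer.ΩTorus l) : j.toZdIdx.Ω = j'.toZdIdx.Ω := by
  funext l
  by_cases hl : l ≤ P
  · have e1 := j.toPer.tcls_preimage_ΩTorus l
    have e2 := j'.toPer.tcls_preimage_ΩTorus l
    rw [hT l hl] at e1
    exact e1.symm.trans e2
  · have hkl : j.toZdIdx.k < l := lt_of_le_of_lt (IdxB8SubDPerκ.k_le_period j) (not_le.1 hl)
    have hkl' : j'.toZdIdx.k < l := hk ▸ hkl
    exact (j.toSubDκ.beyond hkl).trans (j'.toSubDκ.beyond hkl').symm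

include hτp hτt hτs in
/-- ★★★★★★ **THE N05 HEAD's FIVE N06 BINDERS WITH ONE CONSTANT SET FOR ALL MEMBERS OF ITS INDEX AND ALL TRUNCATIONS, AT A FIXED PERIOD, GIVEN AN `η`-LAW** (`2 ≤ D`,
`0 ≤ β`, integer lengths; `η` a function of the depth on the index — print's `η = L⁻ᵏ`, p. 77, which the tree's law №7 relaxes to `Lᵏη ≤ 1`): `∃ aI aT > 0, B₀ > 0, C_β c_S c_Sβ ≥ 0`
with, for EVERY `j : IdxB8SubDPerκ θ P Mκ Rκ` and every `m ≤ k`, `InvAtHIPer … aI ∧ GlobAtIPer … aT B₀ ∧ HolderAtIH2Per … aT C_β β len ∧ SrcAtIPer … aT c_S ∧ SrcHolderAtIH2Per …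
aT c_Sβ β len` for the genuine record `opsAllZdPer τ θ.L P (towerBondsP θ.L j.Ω (j.Λs ·) ·) ops₀ … M j.toZdIdx m` — the head's displayed texts with the constants OUTSIDE
`∀ a` (`a_S := a_T`).  ROUTE: the binders read the member only through `(η, k, Ω, Λs m↾≤m)` (§2) and `Λs m↾≤m` is print's level set of `Ω` (rigidity); at a fixed period
the pairs `(k, (Ω_l read on the torus)_{l ≤ P})` range over a FINITE type, the per-member constants of `IdxB8SubDPer.binders_opsAllZdPer_allLevels` of one representative
per code are combined by `min ∕ max` (the binders are antitone in the thresholds, monotone in the constants), and `η` agrees within a code by the `η`-law.  WITHOUT the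
`η`-law the remaining step is the `η`-SCALING of `Δ_a` (all letters homogeneous of degree `−2` in `η`) — not in this file.
[cite: Balaban1985BackgroundPropagators, Thm 3.11 p.416, Thm 3.3 p.399, (3.42) p.397, (3.43)–(3.47) p.398; Balaban1985RegularSpaces, Thm 8 + (1.146) p.101, (1.58)–(1.59) p.86, (1.3)–(1.6) p.77, (1.31) p.82, p.77 («T_η, η = L^{−k}»)] -/
theorem IdxB8SubDPerκ.binders_uniform_of_eta_law (hD2 : 2 ≤ θ.D) {Cτ : ℝ} (hCτ : ∀ x y : θ.𝔸, |(τ (star x * y)).re| ≤ Cτ * ‖x‖ * ‖y‖)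
    (ops₀ : ℝ → ZdIdx θ.D θ.L → ℕ → OpsZd θ.D θ.𝔸) (M : ℝ) {β : ℝ} (hβ : 0 ≤ β) {len : Site θ.D → ℝ} (hlen : ∀ v : Site θ.D, 0 < len v → 1 ≤ len v)
    (ηfun : ℕ → ℝ) (hηk : ∀ j : IdxB8SubDPerκ θ P Mκ Rκ, j.toZdIdx.η = ηfun j.toZdIdx.k) :
    ∃ aI : ℝ, 0 < aI ∧ ∃ aT : ℝ, 0 < aT ∧ ∃ B₀ : ℝ, 0 < B₀ ∧ ∃ Cβ : ℝ, 0 ≤ Cβ ∧ ∃ cS : ℝ, 0 ≤ cS ∧ ∃ cSβ : ℝ, 0 ≤ cSβ ∧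
      ∀ j : IdxB8SubDPerκ θ P Mκ Rκ, ∀ m, m ≤ j.toZdIdx.k →
        InvAtHIPer P θ.L (opsAllZdPer τ θ.L P (fun k l => towerBondsP θ.L j.toZdIdx.Ω (j.toZdIdx.Λs k) l) ops₀) aI M j.toZdIdx m ∧
        GlobAtIPer P θ.L (opsAllZdPer τ θ.L P (fun k l => towerBondsP θ.L j.toZdIdx.Ω (j.toZdIdx.Λs k) l) ops₀) aT B₀ M j.toZdIdx m ∧
        HolderAtIH2Per P θ.L (opsAllZdPer τ θ.L P (fun k l => towerBondsP θ.L j.toZdIdx.Ω (j.toZdIdx.Λs k) l) ops₀) aT Cβ β len M j.toZdIdx m ∧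
        SrcAtIPer P θ.L (opsAllZdPer τ θ.L P (fun k l => towerBondsP θ.L j.toZdIdx.Ω (j.toZdIdx.Λs k) l) ops₀) aT cS M j.toZdIdx m ∧
        SrcHolderAtIH2Per P θ.L (opsAllZdPer τ θ.L P (fun k l => towerBondsP θ.L j.toZdIdx.Ω (j.toZdIdx.Λs k) l) ops₀) aT cSβ β len M j.toZdIdx m := by
  classical
  -- the five binders at `(j, m)` with constants `v = (aI, aT, B₀, Cβ, cS, cSβ)`
  let Bnd : IdxB8SubDPerκ θ P Mκ Rκ → ℕ → ℝ × ℝ × ℝ × ℝ × ℝ × ℝ → Prop := fun j m v =>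
    InvAtHIPer P θ.L (opsAllZdPer τ θ.L P (fun k l => towerBondsP θ.L j.toZdIdx.Ω (j.toZdIdx.Λs k) l) ops₀) v.1 M j.toZdIdx m ∧
    GlobAtIPer P θ.L (opsAllZdPer τ θ.L P (fun k l => towerBondsP θ.L j.toZdIdx.Ω (j.toZdIdx.Λs k) l) ops₀) v.2.1 v.2.2.1 M j.toZdIdx m ∧
    HolderAtIH2Per P θ.L (opsAllZdPer τ θ.L P (fun k l => towerBondsP θ.L j.toZdIdx.Ω (j.toZdIdx.Λs k) l) ops₀) v.2.1 v.2.2.2.1 β len M j.toZdIdx m ∧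
    SrcAtIPer P θ.L (opsAllZdPer τ θ.L P (fun k l => towerBondsP θ.L j.toZdIdx.Ω (j.toZdIdx.Λs k) l) ops₀) v.2.1 v.2.2.2.2.1 M j.toZdIdx m ∧
    SrcHolderAtIH2Per P θ.L (opsAllZdPer τ θ.L P (fun k l => towerBondsP θ.L j.toZdIdx.Ω (j.toZdIdx.Λs k) l) ops₀) v.2.1 v.2.2.2.2.2 β len M j.toZdIdx m
  let Pos : ℝ × ℝ × ℝ × ℝ × ℝ × ℝ → Prop := fun v => 0 < v.1 ∧ 0 < v.2.1 ∧ 0 < v.2.2.1 ∧ 0 ≤ v.2.2.2.1 ∧ 0 ≤ v.2.2.2.2.1 ∧ 0 ≤ v.2.2.2.2.2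
  -- the per-member package (FILE E §4), in product form
  have pkg : ∀ j : IdxB8SubDPerκ θ P Mκ Rκ, ∃ v : ℝ × ℝ × ℝ × ℝ × ℝ × ℝ, Pos v ∧ ∀ m, m ≤ j.toZdIdx.k → Bnd j m v := by
    intro j
    obtain ⟨aI, haI, aT, haT, B₀, hB₀, Cβ, hCβ, cS, hcS, cSβ, hcSβ, h⟩ :=
      B9Thm33SourceWitnessZdPerNested.IdxB8SubDPerκ.binders_opsAllZdPer_allLevels τ hτp hτt hτs hD2 hCτ j ops₀ M hβ hlen
    exact ⟨(aI, aT, B₀, Cβ, cS, cSβ), ⟨haI, haT, hB₀, hCβ, hcS, hcSβ⟩, h⟩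
  -- the finite code of a member: depth and the torus readings of the domains
  let C : Type := Fin (P + 1) × (Fin (P + 1) → Set (Fin θ.D → ZMod P))
  let code : IdxB8SubDPerκ θ P Mκ Rκ → C := fun j => (⟨j.toZdIdx.k, Nat.lt_succ_of_le (IdxB8SubDPerκ.k_le_period j)⟩, fun l => j.toPer.ΩTorus l)
  -- constants per code
  let V : C → ℝ × ℝ × ℝ × ℝ × ℝ × ℝ := fun c => if h : ∃ j, code j = c then Classical.choose (pkg (Classical.choose h)) else (1, 1, 1, 0, 0, 0)
  have hVpos : ∀ c, Pos (V c) := by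
    intro c
    by_cases h : ∃ j, code j = c
    · simp only [V, dif_pos h]
      exact (Classical.choose_spec (pkg (Classical.choose h))).1
    · simp only [V, dif_neg h, Pos]
      norm_num
  have hne : (Finset.univ : Finset C).Nonempty := Finset.univ_nonempty
  -- the global constants
  refine ⟨Finset.univ.inf' hne (fun c => (V c).1), (Finset.lt_inf'_iff hne).2 (fun c _ => (hVpos c).1),
    Finset.univ.inf' hne (fun c => (V c).2.1), (Finset.lt_inf'_iff hne).2 (fun c _ => (hVpos c).2.1),
    Finset.univ.sup' hne (fun c => (V c).2.2.1), ?_,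
    Finset.univ.sup' hne (fun c => (V c).2.2.2.1), ?_,
    Finset.univ.sup' hne (fun c => (V c).2.2.2.2.1), ?_,
    Finset.univ.sup' hne (fun c => (V c).2.2.2.2.2), ?_, fun j m hm => ?_⟩
  · obtain ⟨c, hc⟩ := hne
    exact lt_of_lt_of_le (hVpos c).2.2.1 (Finset.le_sup' (fun c => (V c).2.2.1) (Finset.mem_univ c))
  · obtain ⟨c, hc⟩ := hne
    exact le_trans (hVpos c).2.2.2.1 (Finset.le_sup' (fun c => (V c).2.2.2.1) (Finset.mem_univ c))
  · obtain ⟨c, hc⟩ := hne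
    exact le_trans (hVpos c).2.2.2.2.1 (Finset.le_sup' (fun c => (V c).2.2.2.2.1) (Finset.mem_univ c))
  · obtain ⟨c, hc⟩ := hne
    exact le_trans (hVpos c).2.2.2.2.2 (Finset.le_sup' (fun c => (V c).2.2.2.2.2) (Finset.mem_univ c))
  -- the representative of `j`'s code
  have hcj : ∃ j', code j' = code j := ⟨j, rfl⟩
  set j' : IdxB8SubDPerκ θ P Mκ Rκ := Classical.choose hcj with hj'
  have hcode : code j' = code j := Classical.choose_spec hcj
  have hV : V (code j) = Classical.choose (pkg j') := by simp only [V, dif_pos hcj]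
  obtain ⟨-, hB⟩ := Classical.choose_spec (pkg j')
  -- the two members agree on `(η, k, Ω, Λs m↾≤m)`
  have hk : j'.toZdIdx.k = j.toZdIdx.k := by
    have := congrArg (fun c : C => (c.1 : ℕ)) hcode
    exact this
  have hT : ∀ l, l ≤ P → j'.toPer.ΩTorus l = j.toPer.ΩTorus l := fun l hl => by
    have := congrArg (fun c : C => c.2 ⟨l, Nat.lt_succ_of_le hl⟩) hcode
    exact this
  have hΩ : j'.toZdIdx.Ω = j.toZdIdx.Ω := IdxB8SubDPerκ.Ω_eq_of_code_eq j' j hk hT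
  have hη : j'.toZdIdx.η = j.toZdIdx.η := by rw [hηk j', hηk j, hk]
  have hm' : m ≤ j'.toZdIdx.k := hk ▸ hm
  have hΛ : ∀ l, l ≤ m → j'.toZdIdx.Λs m l = j.toZdIdx.Λs m l := by
    intro l hl
    have e1 : j'.toZdIdx.Λs m l = B11Eq7Convention.Lam θ.L j'.toZdIdx.Ω m l := j'.toPer.Λs_eq_lam hm' hl
    have e2 : j.toZdIdx.Λs m l = B11Eq7Convention.Lam θ.L j.toZdIdx.Ω m l := j.toPer.Λs_eq_lam hm hl
    rw [e1, e2, hΩ]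
  have h𝔅 : ∀ l, l ≤ m → towerBondsP θ.L j'.toZdIdx.Ω (j'.toZdIdx.Λs m) l = towerBondsP θ.L j.toZdIdx.Ω (j.toZdIdx.Λs m) l := by
    intro l hl
    rw [hΩ]
    exact towerBondsP_congr fun l' hl' => hΛ l' (hl'.trans hl)
  -- the binders at the representative with ITS constants, weakened to the global ones, transferred to `j`
  obtain ⟨g1, g2, g3, g4, g5⟩ := hB m hm'
  have hle1 : Finset.univ.inf' hne (fun c => (V c).1) ≤ (Classical.choose (pkg j')).1 := by
    rw [← hV]; exact Finset.inf'_le _ (Finset.mem_univ _)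
  have hle2 : Finset.univ.inf' hne (fun c => (V c).2.1) ≤ (Classical.choose (pkg j')).2.1 := by
    rw [← hV]; exact Finset.inf'_le _ (Finset.mem_univ _)
  have hle3 : (Classical.choose (pkg j')).2.2.1 ≤ Finset.univ.sup' hne (fun c => (V c).2.2.1) := by
    rw [← hV]; exact Finset.le_sup' (fun c => (V c).2.2.1) (Finset.mem_univ _)
  have hle4 : (Classical.choose (pkg j')).2.2.2.1 ≤ Finset.univ.sup' hne (fun c => (V c).2.2.2.1) := by
    rw [← hV]; exact Finset.le_sup' (fun c => (V c).2.2.2.1) (Finset.mem_univ _)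
  have hle5 : (Classical.choose (pkg j')).2.2.2.2.1 ≤ Finset.univ.sup' hne (fun c => (V c).2.2.2.2.1) := by
    rw [← hV]; exact Finset.le_sup' (fun c => (V c).2.2.2.2.1) (Finset.mem_univ _)
  have hle6 : (Classical.choose (pkg j')).2.2.2.2.2 ≤ Finset.univ.sup' hne (fun c => (V c).2.2.2.2.2) := by
    rw [← hV]; exact Finset.le_sup' (fun c => (V c).2.2.2.2.2) (Finset.mem_univ _)
  refine ⟨?_, ?_, ?_, ?_, ?_⟩
  · exact (invAtHIPer_congr τ ops₀ M hη hΩ hΛ h𝔅).1 (B9Eq327GreenZdHermPer.invAtHIPer_anti (h := hle1) (hI := g1))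
  · exact (globAtIPer_congr τ ops₀ M hη hΩ hΛ h𝔅).1 (B9SupplySockB9P3ZdPer.globAtIPer_anti (ha := hle2) (hB := hle3) (h := g2))
  · exact (holderAtIH2Per_congr τ ops₀ M hη hΩ hΛ h𝔅).1 (B9SupplySockB9P3ZdH2Per.holderAtIH2Per_anti (ha := hle2) (hC := hle4) (h := g3))
  · exact (srcAtIPer_congr τ ops₀ M hη hk hΩ hΛ h𝔅).1 (B9SupplySockB9P3ZdSrcPer.srcAtIPer_anti (ha := hle2) (hc := hle5) (h := g4))
  · exact (srcHolderAtIH2Per_congr τ ops₀ M hη hk hΩ hΛ h𝔅).1 (B9SupplySockB9P3ZdSrcPer.srcHolderAtIH2Per_anti (ha := hle2) (hc := hle6) (h := g5))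

end Uniform

end Literature.MathematicalPhysics.QuantumFieldTheory.Balaban1983to89.B9Thm33BindersUniformZdPerNested

end
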